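import Summits.FinalStateConjecture.FinalStateConjecture.Theses.EternalPapapetrou
import Summits.FinalStateConjecture.FinalStateConjecture.Theorems.PhotonSphereChannelsDarkFutureDefs
import Summits.FinalStateConjecture.FinalStateConjecture.Theorems.PhotonSphereChannelsChannelsResolveTameDevelopmentsRHorizonHullBlackHole
import Summits.FinalStateConjecture.FinalStateConjecture.Theorems.PhotonSphereChannelsChannelsResolveTameDevelopmentsRNonRadiatingAllOrders
import Summits.FinalStateConjecture.FinalStateConjecture.Theorems.PhotonSphereChannelsChannelsResolveTameDevelopmentsRKerrDocOfLocalIsometry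
import Summits.FinalStateConjecture.FinalStateConjecture.Theorems.PhotonSphereChannelsChannelsResolveTameDevelopmentsRKerrDocOrientation
import Summits.FinalStateConjecture.FinalStateConjecture.Theorems.PhotonSphereChannelsChannelsResolveTameDevelopmentsRFarDeviationSmooth
import HarnessLib.Audit

/-!
# Crux stmt-FinalStateConjecture-17430 · line `dark-future-exactness` · stub N (`stub_someLimitIsKerr`), part N1:
# REDUCTION of N1 to the two EXISTING cruxes of route EternalPapapetrou (lead c7, cycles 2–3; v2)

N1 (first conjunct of `SomeLimitIsKerr`): for a development as in Φ, a class `(Λ, r₀)` with `GeneratorHullExists`,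
along every horizon generator path `γ` SOME horizon-hull element has a SUB-EXTREMAL Kerr d.o.c. This file proves,
sorry-free, that N1 follows from

* `L = Theses.EternalPapapetrou.FarZoneEternalPapapetrou` (stmt-FinalStateConjecture-10034, open crux, rank 2) and
* `U = Theses.EternalPapapetrou.EternalStationaryExteriorIsKerr` (stmt-FinalStateConjecture-10745, open crux, rank 4)

— whose far-chart hypotheses are LITERALLY those of `TameHull.EndDatum` (`E.B`, `E.h`, `E.hdot` are definitionally the
`B`, `h`, `hₜ` of L/U) — modulo the following glue, of which G0, G1, G3, G4, G4b are LANDED (waves 2–3) and the rest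
(G2, G5, G6) are the selection hypothesis of the theorem below, a statement about ONE element per generator:

* G1 (landed p154205 `isNonRadiating_allOrders`): all-orders far bounds + order-0 non-radiation ⇒ non-radiation at all
  orders (interpolation), fed by G0 (landed p155225 `contDiffAt_farDeviation_of_isTameEnd`: the far deviation of a tame
  end is smooth on the open cylinder);
* G3 (landed p152987 `blackHoleRegion_nonempty_of_isHorizonHullElementAlong`): horizon-hull elements are black-hole
  spacetimes w.r.t. their far end (U's disjunct);
* G4 (landed p152989 `isKerrDoc_of_isLocalIsometry`): U's conclusion shape + black-hole orientation ⇒ `IsKerrDoc`;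
* G4b (landed p155908 `orientationFix_of_subextremal`): U allows the white-hole orientation; `Ψ_* ∂_{t*}` is timelike
  on the connected `{r > 2M}`, hence everywhere future or everywhere past, and in the past case `Ψ ∘ ι`,
  `ι = Kerr.Backwards.exteriorMap` (the proved `(t, φ) ↦ (−t, −φ)` isometry), is future-oriented;
* G2/G5/G6 = `hsel` (SELECTION, the honest ∃ of N1): along `γ` there is a horizon-hull element which is (G2) globally
  hyperbolic (U's hypothesis; trimming makes it non-automatic), (G5) NON-EXTREMAL — every Kerr exterior isometric to
  its d.o.c. up to orientation has `|a| < M'` ((i) `NoExtremalRemnant` in ω-limit form / red-shifted branch of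
  `IsSilent`: the named `ExtremalLimitPromotion` gap of the TSOA dead note, not hidden), and (G6) carries no flat
  structure in U's sense — a spacetime globally isometric to Minkowski with this eternal far chart has EMPTY event
  horizon (asymptotic inertiality of `O(1/r)`-Schwarzschild far charts; contradicts `p ∈ E.horizon`).

So N1's honest residue is {L, U} ∪ {selection of ONE globally hyperbolic, non-extremal, non-flat element per
generator} — N1 is BLOCKED ON the EXISTING ITEMS stmt-10034 ∧ stmt-10745 modulo that selection, not a free-floating
open problem.
N2 (horizonless branch) is NOT covered by U (U needs a black-hole region or geodesic completeness) and stays named.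
-/

noncomputable section

set_option maxSynthPendingDepth 3
set_option linter.dupNamespace false

open Set Filter Function TopologicalSpace Manifold Bundle
open scoped Topology Manifold ContDiff ENNReal NNReal

namespace Summit.FinalStateConjecture.FinalStateConjecture.Cruxes.ChannelsResolveTameDevelopmentsR.DarkFutureExactness.N1

open Literature.Geometry.Lorentzian
open Summit.FinalStateConjecture.FinalStateConjecture.Theorems.TameHull
open Summit.FinalStateConjecture.FinalStateConjecture.Theorems.DarkFuture
open Summit.FinalStateConjecture.FinalStateConjecture.Theses.EternalPapapetrou
  (FarZoneEternalPapapetrou EternalStationaryExteriorIsKerr)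

variable {X : Type} [TopologicalSpace X] [ChartedSpace E3 X] [IsManifold (𝓡 3) ∞ X]
  [T2Space X] [SecondCountableTopology X] [ConnectedSpace X] {D : InitialDataSet (𝓡 3) X}

/-- U's conclusion data for an end: an injective local isometry of the Kerr `(M', a)` exterior onto the d.o.c.
(`|a| ≤ M'` allowed by U), in either time orientation. [folklore] -/
def IsKerrDocUpToOrientation (𝓢 : Spacetime.{0} 4) [Kerr.Facts] (E : EndDatum 𝓢) (M' a : ℝ) : Prop :=
  ∃ Ψ : Kerr.exterior M' a → 𝓢.carrier, Function.Injective Ψ ∧ Set.range Ψ = E.doc ∧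
    PseudoRiemannianMetric.IsLocalIsometry (Kerr.smoothMetric M' a (Kerr.rPlus M' a)).toPseudoRiemannianMetric
      𝓢.metric.toPseudoRiemannianMetric Ψ

/-- **G4b (orientation dichotomy on one end)** — now a THEOREM for sub-extremal parameters
(`orientationFix_of_subextremal`, p155908); kept as a named predicate for the record: if the d.o.c. is a Kerr exterior
up to orientation, some such isometry is FUTURE-oriented outside the ergoregion. [cite: ONeill1995, §2.4] -/
def OrientationFix (𝓢 : Spacetime.{0} 4) [Kerr.Facts] (E : EndDatum 𝓢) : Prop :=
  ∀ M' a : ℝ, 0 < M' → |a| < M' → IsKerrDocUpToOrientation 𝓢 E M' a →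
    ∃ Ψ : Kerr.exterior M' a → 𝓢.carrier, Function.Injective Ψ ∧ Set.range Ψ = E.doc ∧
      PseudoRiemannianMetric.IsLocalIsometry (Kerr.smoothMetric M' a (Kerr.rPlus M' a)).toPseudoRiemannianMetric
        𝓢.metric.toPseudoRiemannianMetric Ψ ∧
      ∀ x : Kerr.exterior M' a, 2 * M' < Kerr.radius a x.1 →
        𝓢.timeOrientation.IsFutureDirected (mfderiv 𝓘(ℝ, E4) (𝓡 4) Ψ x (E4.basisVector 0))

/-- **G6 as a hypothesis (no flat horizon-hull element)**: an end of a spacetime globally isometric to Minkowski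
space has EMPTY future event horizon. [cite: HawkingEllis1973, §5.1] -/
def MinkowskiEndHasNoHorizon (𝓢 : Spacetime.{0} 4) (E : EndDatum 𝓢) : Prop :=
  (∃ Ψ : Diffeomorph (𝓡 4) 𝓘(ℝ, E4) 𝓢.carrier E4 (⊤ : ℕ∞),
      PseudoRiemannianMetric.IsIsometry 𝓢.metric.toPseudoRiemannianMetric
        (Minkowski.metric.ofLE le_top : LorentzianMetric 𝓘(ℝ, E4) (⊤ : ℕ∞) E4).toPseudoRiemannianMetric Ψ) →
    E.horizon = ∅

/-- **THE SELECTION (G2 ∧ G5 ∧ G6 on ONE element per generator)** — the honest ∃ of N1: along every horizon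
generator path of a development as in Φ there is a horizon-hull element which is GLOBALLY HYPERBOLIC, NON-EXTREMAL
in the sense that every Kerr exterior isometric to its d.o.c. (up to orientation) has `|a| < M'`, and satisfies the
no-flat-horizon clause. [cite: DafermosLuk2017, Conjecture 1] -/
def GoodElementSelection : Prop :=
  ∀ (X : Type) [TopologicalSpace X] [ChartedSpace E3 X] [IsManifold (𝓡 3) ∞ X] [T2Space X]
    [SecondCountableTopology X] [ConnectedSpace X], ∀ D ∈ admissibleVacuumData X,
    ∀ (𝒟 : VacuumCauchyDevelopment D) [𝒟.metric.HasLeviCivita], DevHyp 𝒟 →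
      ∀ (Λ : ℕ → ℝ≥0) (r₀ : ℝ), 0 < r₀ → GeneratorHullExists 𝒟 Λ r₀ →
        ∀ γ : ℝ → 𝒟.carrier, IsHorizonPath 𝒟 γ → ∀ [Kerr.Facts],
          ∃ (𝓢 : Spacetime.{0} 4) (E : EndDatum 𝓢) (p : 𝓢.carrier),
            IsHorizonHullElement 𝒟 Λ r₀ γ 𝓢 E p ∧
            𝓢.metric.IsGloballyHyperbolic 𝓢.timeOrientation ∧
            (∀ M' a : ℝ, 0 < M' → |a| ≤ M' → IsKerrDocUpToOrientation 𝓢 E M' a → |a| < M') ∧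
            MinkowskiEndHasNoHorizon 𝓢 E

/-- **N1 from route EternalPapapetrou's cruxes L, U and the selection** (sorry-free): the conclusion is the
first conjunct of the registered `stub_someLimitIsKerr`, verbatim, under `[Kerr.Facts]` (U's standing instance
hypothesis). -/
theorem someLimitIsKerr₁_of_eternalPapapetrou [Kerr.Facts] (hL : FarZoneEternalPapapetrou)
    (hU : EternalStationaryExteriorIsKerr) (hsel : GoodElementSelection) :
    ∀ (X : Type) [TopologicalSpace X] [ChartedSpace E3 X] [IsManifold (𝓡 3) ∞ X] [T2Space X]
      [SecondCountableTopology X] [ConnectedSpace X], ∀ D ∈ admissibleVacuumData X,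
      ∀ (𝒟 : VacuumCauchyDevelopment D) [𝒟.metric.HasLeviCivita], DevHyp 𝒟 →
        ∀ (Λ : ℕ → ℝ≥0) (r₀ : ℝ), 0 < r₀ → GeneratorHullExists 𝒟 Λ r₀ →
          ∀ γ : ℝ → 𝒟.carrier, IsHorizonPath 𝒟 γ →
            ∃ (𝓢 : Spacetime.{0} 4) (E : EndDatum 𝓢) (p : 𝓢.carrier),
              IsHorizonHullElement 𝒟 Λ r₀ γ 𝓢 E p ∧
                ∃ M a : ℝ, 0 < M ∧ |a| < M ∧ IsKerrDoc 𝓢 E.doc M a := by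
  intro X _ _ _ _ _ _ D hD 𝒟 _ hdev Λ r₀ hr₀ hgen γ hγ
  obtain ⟨𝓢, E, p, hZ, hGH, hsub, hmink⟩ := hsel X D hD 𝒟 hdev Λ r₀ hr₀ hgen γ hγ
  refine ⟨𝓢, E, p, hZ, ?_⟩
  obtain ⟨s, hs, hZs⟩ := hZ
  have hcls : IsTameClass E Λ r₀ := hZs.1
  have hsil : E.IsSilent := hZs.2.1
  have htame : E.IsTameEnd (Λ 3) r₀ := hcls.isTameEnd
  have hsmooth : ∀ x : Kerr.region (0 : ℝ) E.R, ContDiffAt ℝ ∞ E.h x.1 :=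
    contDiffAt_farDeviation_of_isTameEnd E (Λ 3) r₀ htame
  have hor : OrientationFix 𝓢 E := fun M' a hM' ha' h ↦ orientationFix_of_subextremal E.doc M' a hM' ha' h
  haveI : 𝓢.metric.HasLeviCivita := 𝓢.metric.toPseudoRiemannianMetric.hasLeviCivita
  -- the far data of `E` in the shape of L / U
  have hM : 0 ≤ E.M := htame.mass_nonneg
  have hR : max (2 * E.M) 0 < E.R := htame.lt_R
  have hRpos : 0 < E.R := lt_of_le_of_lt (le_max_right _ _) hR
  have hvac : 𝓢.metric.toPseudoRiemannianMetric.IsRicciFlat := htame.vacuum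
  have hfar_bound : ∀ k : ℕ, ∀ m ≤ k, ∀ x : Kerr.region (0 : ℝ) E.R,
      ‖iteratedFDeriv ℝ m E.h x.1‖ * Kerr.radius 0 x.1 ≤ Λ k := fun k ↦ (hcls.order k).far_bound
  have hnonrad : ∀ m : ℕ, ∀ δ > (0 : ℝ), ∃ R' : ℝ, ∀ x : Kerr.region (0 : ℝ) E.R,
      R' < Kerr.radius 0 x.1 → ‖iteratedFDeriv ℝ m E.hdot x.1‖ * Kerr.radius 0 x.1 ≤ δ :=
    isNonRadiating_allOrders E Λ hRpos hsmooth hfar_bound hsil.1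
  -- L: stationarity near infinity
  obtain ⟨kL, hkL⟩ := hL
  have hstat := hkL E.M E.R (Λ kL) hM hR 𝓢 hvac E.far htame.far_isLocalDiffeomorph htame.far_injective
    (hfar_bound kL) (fun m _ ↦ hnonrad m)
  -- U: the d.o.c. is a Kerr exterior up to orientation, or the spacetime is Minkowski
  obtain ⟨kU, hkU⟩ := hU
  have hbh : (𝓢.blackHoleRegionOfEnd (Set.range E.far)).Nonempty :=
    blackHoleRegion_nonempty_of_isHorizonHullElementAlong hZs
  have hdich := hkU E.M E.R (Λ kU) hM hR 𝓢 hvac hGH E.far htame.far_isLocalDiffeomorph htame.far_injective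
    (hfar_bound kU) (fun m _ ↦ hnonrad m) hstat (Or.inl hbh)
  rcases hdich with ⟨M', a, hM', ha, Ψ, hinj, hrange, hiso⟩ | ⟨Ψ, hΨ⟩
  · -- Kerr branch: sub-extremal by the selection, future-oriented by the orientation fix, `IsKerrDoc` by G4
    have hupto : IsKerrDocUpToOrientation 𝓢 E M' a := ⟨Ψ, hinj, hrange, hiso⟩
    have ha' : |a| < M' := hsub M' a hM' ha hupto
    obtain ⟨Ψ', hinj', hrange', hiso', hfut'⟩ := hor M' a hM' ha' hupto
    exact ⟨M', a, hM', ha', isKerrDoc_of_isLocalIsometry E.doc M' a Ψ' hinj' hrange' hiso' hfut'⟩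
  · -- Minkowski branch: impossible for a horizon-hull element (its base point is a horizon point)
    have hempty : E.horizon = ∅ := hmink ⟨Ψ, hΨ⟩
    have hp : p ∈ E.horizon := hZs.2.2.1
    rw [hempty] at hp
    exact absurd hp (Set.notMem_empty p)

end Summit.FinalStateConjecture.FinalStateConjecture.Cruxes.ChannelsResolveTameDevelopmentsR.DarkFutureExactness.N1

end
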